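import Summits.Ventures.HodgeRepro2.T5InertIwasawaCosets

/-!
# The unramified principal series of `U(2,1)` at an inert place: the right regular representation, the induced
functions, and the spherical vector
(cell pub-hodge-repro2, seat p3)

Tier-5 N3 support, towards the Macdonald–Satake identification (the one sentence of the Satake chain still in
print after files 209–214). The unramified principal series `I(χ)` is the space of `k`-valued functions on
`G = U(J₃(u))` with `f(b g) = (χ δ_B^{1/2})(b) f(g)` for `b` in the Borel `B = N · T`, under right translation;
with `c := (χ δ_B^{1/2})(a₁)` the law reads `f(n g) = f(g)` and `f(a_m g) = c^m f(g)`. This file: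

* **`rightRegular`** — the right regular representation `(ρ g f)(x) = f(x g)` of `G` on `G → k`;
* **`IsInduced c f`** — the transformation law under `N` and the cells;
* `isInduced_rightRegular`, `isInduced_add`, `isInduced_smul`, `isInduced_finsum` — `I(c)` is a `ρ`-stable subspace;
* **`apply_mul_cellZ_mul_of_mem_invariants`** — a right-`K`-invariant `f ∈ I(c)` has `f(n a_m κ) = c^m f(1)`;
* `eq_smul_of_iwasawa` — under the Iwasawa decomposition `G = N {a_m} K` such an `f` is `f(1) • f₀`;
* **`heckeSMul_doubleCosetOp_apply_one`** — `(T_g f)(1) = ∑_{xK ∈ K g K / K} f(x)` (p8's `heckeSMul`);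
* **`heckeSMul_eq_smul_of_iwasawa`** — for the spherical vector `f₀` (`f₀(1) = 1`): `T_g f₀ = (T_g f₀)(1) • f₀`.

Mathlib + this seat's file 215 and its imports (p8's Hecke-module files); no display; no device.
§8(d): uses an L-value-free non-vanishing device: NO.
-/

namespace Summit.Ventures.HodgeRepro2.T5InertPrincipalSeries

open Summit.Ventures.HodgeRepro2.T5CartanCellsDistinct Summit.Ventures.HodgeRepro2.T5HeckeBasisCells
  Summit.Ventures.HodgeRepro2.T5HermitianThreeElements Summit.Ventures.HodgeRepro2.T5UnitaryGroupForm
  Summit.Ventures.HodgeRepro2.T5UnitaryHeckeAdjoint Summit.Ventures.HodgeRepro2.T5HeckePermutationModule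
  Summit.Ventures.HodgeRepro2.T5HeckeDoubleCoset Summit.Ventures.HodgeRepro2.T5InertUnipotentRadical
  Summit.Ventures.HodgeRepro2.T5InertIwasawaCosets

/-! ## The right regular representation -/

section Regular

variable {G : Type*} [Group G] (k : Type*) [Field k]

/-- **The right regular representation** of a group on `k`-valued functions: `(ρ g f)(x) = f(x g)`. -/
noncomputable def rightRegular : Representation k G (G → k) where
  toFun g := LinearMap.funLeft k k (fun x => x * g)
  map_one' := by
    ext f x
    simp [LinearMap.funLeft_apply]
  map_mul' g h := by
    ext f x
    simp [LinearMap.funLeft_apply, mul_assoc]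

/-- `(ρ g f)(x) = f(x g)`. -/
theorem rightRegular_apply (g : G) (f : G → k) (x : G) : rightRegular k g f x = f (x * g) := rfl

/-- A function is `K`-invariant for `ρ` iff it is right-`K`-invariant. -/
theorem mem_invariants_rightRegular_iff (K : Subgroup G) (f : G → k) :
    f ∈ LevelPositivity.invariants (rightRegular k) K ↔ ∀ κ ∈ K, ∀ x, f (x * κ) = f x := by
  rw [LevelPositivity.mem_invariants_iff]
  constructor
  · intro h κ hκ x
    have := congrFun (h κ hκ) x
    rwa [rightRegular_apply] at this
  · intro h κ hκ
    ext x
    rw [rightRegular_apply, h κ hκ]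

omit [Group G] in
/-- Evaluation commutes with a finite sum of functions. -/
theorem finsum_mem_apply {ι : Type*} {s : Set ι} (hs : s.Finite) (F : ι → G → k) (y : G) :
    (∑ᶠ x ∈ s, F x) y = ∑ᶠ x ∈ s, F x y := by
  rw [finsum_mem_eq_finite_toFinset_sum _ hs, finsum_mem_eq_finite_toFinset_sum _ hs, Finset.sum_apply]

/-- **`(T_g f)(y) = ∑_{xK ∈ K g K / K} (ρ(x) f)(y)`** for a right-`K`-invariant `f` (p8's `heckeSMul`). -/
theorem heckeSMul_doubleCosetOp_apply (K : Subgroup G) (g : G) [Finite (MulAction.orbit K (g : G ⧸ K))]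
    (f : LevelPositivity.invariants (rightRegular k) K) (y : G) :
    (heckeSMul (rightRegular k) (doubleCosetOp k K g) f : G → k) y =
      ∑ᶠ x ∈ MulAction.orbit K (g : G ⧸ K), orbitMap (rightRegular k) (f : G → k) f.2 x y := by
  rw [heckeSMul_doubleCosetOp, finsum_mem_apply k (Set.toFinite _)]

/-- `orbitMap ρ f _ (xK)` evaluated at `1` is `f(x)`. -/
theorem orbitMap_rightRegular_mk_apply_one (K : Subgroup G) (f : G → k)
    (hf : f ∈ LevelPositivity.invariants (rightRegular k) K) (x : G) :
    orbitMap (rightRegular k) f hf (x : G ⧸ K) 1 = f x := by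
  rw [orbitMap_mk, rightRegular_apply, one_mul]

end Regular

/-! ## The induced functions `I(c)` and the spherical vector -/

section Induced

variable {R E : Type*} [CommRing R] [Field E] [StarRing E] [Algebra R E] [IsFractionRing R E]
  (u : E) {ϖ : R} (hϖ : Irreducible ϖ) (hs : star (algebraMap R E ϖ) = algebraMap R E ϖ)
  (k : Type*) [Field k]

/-- **The unramified principal series `I(c)`**, `c = (χ δ_B^{1/2})(a₁)`: the functions with `f(n g) = f(g)` for
`n ∈ N` and `f(a_m g) = c^m f(g)` for every cell `a_m`. -/
def IsInduced (c : k) (f : formUnitaryGroup (J3 u) → k) : Prop :=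
  (∀ n ∈ upperUnipotent u, ∀ g, f (n * g) = f g) ∧
    ∀ (m : ℤ) (g : formUnitaryGroup (J3 u)), f (cellZ u hϖ hs m * g) = c ^ m * f g

variable {u hϖ hs k}

/-- `I(c)` is stable under right translation. -/
theorem isInduced_rightRegular {c : k} {f : formUnitaryGroup (J3 u) → k} (hf : IsInduced u hϖ hs k c f)
    (g : formUnitaryGroup (J3 u)) : IsInduced u hϖ hs k c (rightRegular k g f) :=
  ⟨fun n hn x => by rw [rightRegular_apply, rightRegular_apply, mul_assoc, hf.1 n hn],
    fun m x => by rw [rightRegular_apply, rightRegular_apply, mul_assoc, hf.2 m]⟩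

/-- `I(c)` is closed under addition. -/
theorem isInduced_add {c : k} {f f' : formUnitaryGroup (J3 u) → k} (hf : IsInduced u hϖ hs k c f)
    (hf' : IsInduced u hϖ hs k c f') : IsInduced u hϖ hs k c (f + f') :=
  ⟨fun n hn x => by simp only [Pi.add_apply, hf.1 n hn, hf'.1 n hn],
    fun m x => by simp only [Pi.add_apply, hf.2 m, hf'.2 m, mul_add]⟩

/-- `0 ∈ I(c)`. -/
theorem isInduced_zero (c : k) : IsInduced u hϖ hs k c 0 :=
  ⟨fun _ _ _ => rfl, fun _ _ => by simp⟩

/-- `I(c)` is closed under scalars. -/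
theorem isInduced_smul {c : k} {f : formUnitaryGroup (J3 u) → k} (hf : IsInduced u hϖ hs k c f) (a : k) :
    IsInduced u hϖ hs k c (a • f) :=
  ⟨fun n hn x => by simp only [Pi.smul_apply, hf.1 n hn],
    fun m x => by simp only [Pi.smul_apply, hf.2 m, smul_eq_mul]; ring⟩

/-- `I(c)` is closed under finite sums. -/
theorem isInduced_finset_sum {ι : Type*} (s : Finset ι) {c : k} {F : ι → formUnitaryGroup (J3 u) → k}
    (hF : ∀ i ∈ s, IsInduced u hϖ hs k c (F i)) : IsInduced u hϖ hs k c (∑ i ∈ s, F i) := by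
  classical
  induction s using Finset.induction_on with
  | empty => simpa using isInduced_zero c
  | insert a s ha ih =>
    rw [Finset.sum_insert ha]
    exact isInduced_add (hF a (Finset.mem_insert_self a s)) (ih fun i hi => hF i (Finset.mem_insert_of_mem hi))

/-- `I(c)` is closed under finite `finsum`s over a finite index set. -/
theorem isInduced_finsum_mem {ι : Type*} {S : Set ι} (hS : S.Finite) {c : k}
    {F : ι → formUnitaryGroup (J3 u) → k} (hF : ∀ i ∈ S, IsInduced u hϖ hs k c (F i)) :
    IsInduced u hϖ hs k c (∑ᶠ i ∈ S, F i) := by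
  rw [finsum_mem_eq_finite_toFinset_sum _ hS]
  exact isInduced_finset_sum _ fun i hi => hF i (hS.mem_toFinset.1 hi)

variable {K : Subgroup (formUnitaryGroup (J3 u))}

/-- **A right-`K`-invariant `f ∈ I(c)` takes the value `c^m f(1)` on `N a_m K`.** -/
theorem apply_mul_cellZ_mul {c : k} {f : formUnitaryGroup (J3 u) → k} (hf : IsInduced u hϖ hs k c f)
    (hK : ∀ κ ∈ K, ∀ x, f (x * κ) = f x) {n : formUnitaryGroup (J3 u)} (hn : n ∈ upperUnipotent u) (m : ℤ)
    {κ : formUnitaryGroup (J3 u)} (hκ : κ ∈ K) : f (n * cellZ u hϖ hs m * κ) = c ^ m * f 1 := by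
  rw [hK κ hκ, hf.1 n hn, ← mul_one (cellZ u hϖ hs m), hf.2 m]

/-- **Under the Iwasawa decomposition `G = N {a_m} K`** a right-`K`-invariant `f ∈ I(c)` is `f(1) • f₀` for the
spherical vector `f₀` (`f₀(1) = 1`). -/
theorem eq_smul_of_iwasawa
    (hIw : ∀ g : formUnitaryGroup (J3 u), ∃ n ∈ upperUnipotent u, ∃ m : ℤ, ∃ κ ∈ K, g = n * cellZ u hϖ hs m * κ)
    {c : k} {f f₀ : formUnitaryGroup (J3 u) → k} (hf : IsInduced u hϖ hs k c f)
    (hfK : ∀ κ ∈ K, ∀ x, f (x * κ) = f x) (hf₀ : IsInduced u hϖ hs k c f₀)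
    (hf₀K : ∀ κ ∈ K, ∀ x, f₀ (x * κ) = f₀ x) (h1 : f₀ 1 = 1) : f = f 1 • f₀ := by
  ext g
  obtain ⟨n, hn, m, κ, hκ, rfl⟩ := hIw g
  rw [Pi.smul_apply, apply_mul_cellZ_mul hf hfK hn m hκ, apply_mul_cellZ_mul hf₀ hf₀K hn m hκ, h1, mul_one,
    smul_eq_mul, mul_comm]

/-- **The spherical vector is a Hecke eigenvector**: under the Iwasawa decomposition, for `f₀ ∈ I(c)` right-`K`-
invariant with `f₀(1) = 1`, `T_g f₀ = (T_g f₀)(1) • f₀` for every double-coset operator `T_g` (p8's `heckeSMul`). -/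
theorem heckeSMul_eq_smul_of_iwasawa
    (hIw : ∀ g : formUnitaryGroup (J3 u), ∃ n ∈ upperUnipotent u, ∃ m : ℤ, ∃ κ ∈ K, g = n * cellZ u hϖ hs m * κ)
    {c : k} {f₀ : formUnitaryGroup (J3 u) → k} (hf₀ : IsInduced u hϖ hs k c f₀)
    (hf₀K : f₀ ∈ LevelPositivity.invariants (rightRegular k) K) (h1 : f₀ 1 = 1)
    (g : formUnitaryGroup (J3 u)) [Finite (MulAction.orbit K (g : formUnitaryGroup (J3 u) ⧸ K))] :
    heckeSMul (rightRegular k) (doubleCosetOp k K g) ⟨f₀, hf₀K⟩ =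
      ((heckeSMul (rightRegular k) (doubleCosetOp k K g) ⟨f₀, hf₀K⟩ : formUnitaryGroup (J3 u) → k) 1) •
        ⟨f₀, hf₀K⟩ := by
  set F := heckeSMul (rightRegular k) (doubleCosetOp k K g) ⟨f₀, hf₀K⟩ with hF
  -- `F ∈ I(c)`: a finite sum of right translates of `f₀`
  have hFind : IsInduced u hϖ hs k c (F : formUnitaryGroup (J3 u) → k) := by
    rw [hF, heckeSMul_doubleCosetOp]
    refine isInduced_finsum_mem (Set.toFinite _) fun x _ => ?_
    obtain ⟨g', rfl⟩ := QuotientGroup.mk_surjective x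
    rw [orbitMap_mk]
    exact isInduced_rightRegular hf₀ g'
  have hFK : ∀ κ ∈ K, ∀ x, (F : formUnitaryGroup (J3 u) → k) (x * κ) = (F : formUnitaryGroup (J3 u) → k) x :=
    (mem_invariants_rightRegular_iff k K _).1 F.2
  apply Subtype.ext
  exact eq_smul_of_iwasawa hIw hFind hFK hf₀ ((mem_invariants_rightRegular_iff k K _).1 hf₀K) h1

end Induced

end Summit.Ventures.HodgeRepro2.T5InertPrincipalSeries
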